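import Summits.Ventures.Crystal3D.LocalLP.ContactBridge
import Summits.Ventures.Crystal3D.Theorems.StickyWulffConstantTextureLiminfTexShadowUnsaturateV5
import HarnessLib

/-!
# Line `TexShadow` at LAW v5 — the COMPOSITION `ShadowTheoremAt ⇒ TexLiminfAt` at every law (Bolzano–Weierstrass, `p = 1`)
# (T-V5 PORT, file P2b; lane T; crux `TextureLiminfV5`, stmt-Ventures-23912; cf-p1 g30 memo HOME/cf-p1/T-V5-PORT.md)

HONEST FRAMING. Venture `Summits/Ventures/Crystal3D` (cell `crystal3d-full`), route `route-Ventures-StickyWulffConstant`, helper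
`--supports` the law-v5 crux `TextureLiminfV5` (stmt-Ventures-23912).  Pure proof, standard axioms; rung F-C1 not moved.

The §5 composition of the planner's skeleton (`TextureLiminf_holds_of_stubs`, HOME/cf-p1/route/lines/tex/TexShadow.lean v6.20:
the single-configuration shadow theorem gives the profile form of the route item along a subsequence on which the normalised
deficiencies converge — `tendsto_subseq_of_bounded` on `[0, max K 0]`, one texture `p = 1` at a far enough index), made a TREE
THEOREM for every law `(c₀, c₁)` and every pair of wall siblings:
* `texLiminfAt_of_shadowTheoremAt : ShadowTheoremAt c₀ c₁ GWF CWL → TexLiminfAt c₀ c₁ GWF CWL`;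
* law v5: `textureLiminfV5_of_shadowTheoremV5`, **`textureLiminfV5_of_shadowTheoremSatV5 : ShadowTheoremSatV5 →
  Theses.StickyWulffConstant.TextureLiminfV5`** — TexShadow v7's composition is this one call on `stub_textureBuild …`;
* law v4 (same proof, by `shadowTheorem_iff_at` / `textureLiminf_iff_at`): `textureLiminf_of_shadowTheorem`,
  `textureLiminf_of_shadowTheoremSat : ShadowTheoremSat → Theses.StickyWulffConstant.TextureLiminf` (v6.20's §5 in one call).
WHAT THIS IS NOT: any progress on `stub_textureBuild` or the wall laws — the route items are NOT closed here (the shadow theorems are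
hypotheses); F-C1 not moved.
-/

open scoped BigOperators InnerProductSpace ENNReal Pointwise
open MeasureTheory Filter Finset

namespace Summit.Ventures.Crystal3D.Cruxes.TextureLiminf.TexShadow

open Summit.Ventures.Crystal3D

/-- **The shadow theorem at law `(c₀, c₁)` gives the profile form of the route item at that law** (Bolzano–Weierstrass on the
normalised deficiencies, one texture, `p = 1`; the v6.20 §5 composition verbatim with the law and the wall siblings as parameters). -/
theorem texLiminfAt_of_shadowTheoremAt {c₀ c₁ : ℝ} {GWF CWL : Prop} (hSh : ShadowTheoremAt c₀ c₁ GWF CWL) :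
    TexLiminfAt c₀ c₁ GWF CWL := by
  intro hG hF hNRG hSL K δ θ hδ hθ Nseq x hx hNseq hK
  obtain ⟨N₀, hN₀⟩ := hSh hG hF hNRG hSL K δ (θ / 3) hδ (by positivity)
  -- the normalised deficiencies form a bounded sequence
  let a : ℕ → ℝ := fun k =>
    (6 * (Nseq k : ℝ) - (numContacts (x k) : ℝ)) / (Nseq k : ℝ) ^ ((2 : ℝ) / 3)
  have ha_mem : ∀ k, a k ∈ Set.Icc (0 : ℝ) (max K 0) := by
    intro k
    have hle : (numContacts (x k) : ℝ) ≤ 6 * (Nseq k : ℝ) := by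
      exact_mod_cast numContacts_le_six_mul (hx k)
    have hD0 : (0 : ℝ) ≤ 6 * (Nseq k : ℝ) - (numContacts (x k) : ℝ) := by linarith
    have hpow : (0 : ℝ) ≤ (Nseq k : ℝ) ^ ((2 : ℝ) / 3) := Real.rpow_nonneg (Nat.cast_nonneg _) _
    refine ⟨div_nonneg hD0 hpow, ?_⟩
    rcases hpow.eq_or_lt with h0 | hpos
    · show (6 * (Nseq k : ℝ) - (numContacts (x k) : ℝ)) / (Nseq k : ℝ) ^ ((2 : ℝ) / 3) ≤ max K 0
      rw [← h0, div_zero]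
      exact le_max_right _ _
    · show (6 * (Nseq k : ℝ) - (numContacts (x k) : ℝ)) / (Nseq k : ℝ) ^ ((2 : ℝ) / 3) ≤ max K 0
      rw [div_le_iff₀ hpos]
      calc 6 * (Nseq k : ℝ) - (numContacts (x k) : ℝ) ≤ K * (Nseq k : ℝ) ^ ((2 : ℝ) / 3) := hK k
        _ ≤ max K 0 * (Nseq k : ℝ) ^ ((2 : ℝ) / 3) := by gcongr; exact le_max_left _ _
  obtain ⟨ℓ, -, φ, hφ, hlim⟩ :=
    tendsto_subseq_of_bounded (Metric.isBounded_Icc (0 : ℝ) (max K 0)) ha_mem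
  refine ⟨φ, hφ, ?_⟩
  have hNφ : Tendsto (Nseq ∘ φ) atTop atTop := hNseq.comp hφ.tendsto_atTop
  have hev1 : ∀ᶠ k in atTop, N₀ ≤ Nseq (φ k) := hNφ.eventually_ge_atTop N₀
  have hev2 : ∀ᶠ k in atTop, dist (a (φ k)) ℓ < θ / 3 :=
    (Metric.tendsto_nhds.1 hlim) (θ / 3) (by positivity)
  obtain ⟨k₀, hk₀N, hk₀d⟩ := (hev1.and hev2).exists
  obtain ⟨n, G, A, c, m, hT, hvol, hEn⟩ :=
    hN₀ (Nseq (φ k₀)) hk₀N (x (φ k₀)) (hx _) (hK _)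
  refine ⟨1, fun _ => n, fun _ => G, fun _ => A, fun _ => c, fun _ => m, fun _ => hT, ?_, ?_⟩
  · simpa using hvol
  · filter_upwards [hev2] with k hk
    simp only [Finset.univ_unique, Fin.default_eq_zero, Finset.sum_singleton]
    change energy n G A c m - θ ≤ a (φ k)
    have hEn' : energy n G A c m ≤ a (φ k₀) + θ / 3 := hEn
    rw [Real.dist_eq] at hk hk₀d
    linarith [abs_lt.1 hk, abs_lt.1 hk₀d]

/-! ## Law v5 -/

/-- The shadow theorem at law v5 gives the ROUTE item `TextureLiminfV5` (stmt-Ventures-23912). -/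
theorem textureLiminfV5_of_shadowTheoremV5 (h : ShadowTheoremV5) :
    Summit.Ventures.Crystal3D.Theses.StickyWulffConstant.TextureLiminfV5 :=
  textureLiminfV5_iff.2 (texLiminfAt_of_shadowTheoremAt h)

/-- **TexShadow v7's composition in one call**: the SATURATED shadow theorem at law v5 gives the ROUTE item `TextureLiminfV5`
(stmt-Ventures-23912) — saturation WLOG (`shadowTheoremV5_of_sat`) then Bolzano–Weierstrass. -/
theorem textureLiminfV5_of_shadowTheoremSatV5 (h : ShadowTheoremSatV5) :
    Summit.Ventures.Crystal3D.Theses.StickyWulffConstant.TextureLiminfV5 :=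
  textureLiminfV5_of_shadowTheoremV5 (shadowTheoremV5_of_sat h)

/-! ## Law v4 (the strong form, same proof) -/

/-- The v4 shadow theorem gives the ROUTE item `TextureLiminf` (stmt-Ventures-19483; v6.20's §5 composition as a tree theorem). -/
theorem textureLiminf_of_shadowTheorem (h : ShadowTheorem) :
    Summit.Ventures.Crystal3D.Theses.StickyWulffConstant.TextureLiminf :=
  textureLiminf_iff_at.2 (texLiminfAt_of_shadowTheoremAt (shadowTheorem_iff_at.1 h))

/-- The v4 SATURATED shadow theorem gives the ROUTE item `TextureLiminf` (stmt-Ventures-19483) in one call. -/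
theorem textureLiminf_of_shadowTheoremSat (h : ShadowTheoremSat) :
    Summit.Ventures.Crystal3D.Theses.StickyWulffConstant.TextureLiminf :=
  textureLiminf_of_shadowTheorem (shadowTheorem_of_shadowTheoremSat h)

end Summit.Ventures.Crystal3D.Cruxes.TextureLiminf.TexShadow
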